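import Summits.NavierStokesRegularity.NavierStokesRegularity.Theorems.AxisymmetricExtremalityPFoldToAxisymmetricMotionTools

/-!
# Route AxisymmetricExtremality — crux `PFoldToAxisymmetric`, line `birth`: axis pinning (core)

Support file (lead, stub `stub_axisPinning` of item stmt-NavierStokesRegularity-15454). The
load-bearing geometric lemma of the line, `horizontal_offsets_bounded` (= the registered helper stub
`stub_offsetsBounded`, a file-packaging split of `stub_axisPinning`): if `L³` fields `v_j`,
EXACTLY equivariant (with all iterates) under the rotation by `θ_j → 0` about the vertical axis
through the horizontal point `b_j`, converge in `L³` to a NON-ZERO field `u`, then the offsets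
`‖b_j‖` stay bounded. Proof: otherwise `D_j = ‖b_j‖ → ∞` along a subsequence; with
`m_j = ⌈(θ_j D_j)⁻¹⌉` the `m_j`-th iterate of the symmetry is a rotation by `φ_j = m_j θ_j → 0`
composed with a horizontal translation of length `≥ (2/π) φ_j D_j ≥ 2/π` (Jordan's inequality), and
`‖u ∘ A_j − u‖_{L³} ≤ 2‖v_j − u‖_{L³} + ‖R_{φ_j} ∘ u − u‖_{L³} → 0` along these motions forces `u = 0`
by `eLpNorm_eq_zero_of_tendsto_motion_of_norm_ge` (`…MotionTools`). Also: the algebra moving the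
symmetry through the Rusin–Šverák modulation `λ W(λ · − x₀)` and through recentring.
All folklore; no Navier–Stokes input.
-/

noncomputable section

-- single-conjunct summit: `Summit.<Summit>.<Problem>` repeats the name by the D-0017 layout
set_option linter.dupNamespace false

namespace Summit.NavierStokesRegularity.NavierStokesRegularity.Theorems.PFoldToAxisymmetric.AxisPinning

open MeasureTheory Filter Topology Set Function
open scoped ENNReal NNReal
open Literature.Analysis.FluidPDE

/-! ### Algebra of the symmetry: iterates, modulation, recentring -/

/-- Iterating an exact rotational symmetry: if `W ∘ R_α = R_α ∘ W` then `W ∘ R_{mα} = R_{mα} ∘ W`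
for every `m : ℕ` (`rotZ_add`). [folklore] -/
theorem rotZ_equivariant_nsmul {W : EuclideanSpace ℝ (Fin 3) → EuclideanSpace ℝ (Fin 3)} {α : ℝ}
    (h : ∀ x, W (rotZ α x) = rotZ α (W x)) (m : ℕ) (x : EuclideanSpace ℝ (Fin 3)) :
    W (rotZ (m * α) x) = rotZ (m * α) (W x) := by
  induction m generalizing x with
  | zero => simp
  | succ m ih =>
    have h1 : ((m + 1 : ℕ) : ℝ) * α = m * α + α := by push_cast; ring
    rw [h1, rotZ_add, rotZ_add, ih, h]

/-- **Modulation moves the symmetry axis.** If `W` is exactly `R_α`-equivariant about the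
`x 2`-axis, then the modulated field `v = λ W(λ · − x₀)` (`rescaleData λ (W (· − x₀))`, `λ ≠ 0`)
is `R_α`-equivariant about the vertical axis through `a = λ⁻¹ x₀`:
`v (R_α x + (a − R_α a)) = R_α (v x)`. [folklore] -/
theorem rescaleData_translate_equivariant {W : EuclideanSpace ℝ (Fin 3) → EuclideanSpace ℝ (Fin 3)}
    {α : ℝ} (h : ∀ x, W (rotZ α x) = rotZ α (W x)) {lam : ℝ} (hlam : lam ≠ 0)
    (x₀ x : EuclideanSpace ℝ (Fin 3)) :
    rescaleData lam (fun y => W (y - x₀)) (rotZ α x + (lam⁻¹ • x₀ - rotZ α (lam⁻¹ • x₀))) =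
      rotZ α (rescaleData lam (fun y => W (y - x₀)) x) := by
  have rotZ_smul : ∀ (c : ℝ) (y : EuclideanSpace ℝ (Fin 3)), rotZ α (c • y) = c • rotZ α y :=
    fun c y => (rotZL α).map_smul c y
  have rotZ_sub_vec : ∀ y z : EuclideanSpace ℝ (Fin 3), rotZ α (y - z) = rotZ α y - rotZ α z :=
    fun y z => (rotZL α).map_sub y z
  simp only [rescaleData]
  have h1 : lam • (rotZ α x + (lam⁻¹ • x₀ - rotZ α (lam⁻¹ • x₀))) - x₀ = rotZ α (lam • x - x₀) := by
    simp only [rotZ_smul, smul_add, smul_sub, smul_smul, mul_inv_cancel₀ hlam, one_smul,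
      rotZ_sub_vec]
    abel
  rw [h1, h, rotZ_smul]

/-- The displacement `a − R_α a` only sees the horizontal part `(a 0, a 1, 0)` of `a`. [folklore] -/
theorem sub_rotZ_eq_horizontal (α : ℝ) (a : EuclideanSpace ℝ (Fin 3)) :
    a - rotZ α a = WithLp.toLp 2 ![a 0, a 1, 0] - rotZ α (WithLp.toLp 2 ![a 0, a 1, 0]) := by
  ext i
  fin_cases i <;> simp

/-- **Recentring.** If `v (R_α x + (b − R_α b)) = R_α (v x)` for all `x`, then the translate
`V = v(· + b)` is exactly `R_α`-equivariant about the `x 2`-axis itself. [folklore] -/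
theorem translate_equivariant {v : EuclideanSpace ℝ (Fin 3) → EuclideanSpace ℝ (Fin 3)} {α : ℝ}
    {b : EuclideanSpace ℝ (Fin 3)} (h : ∀ x, v (rotZ α x + (b - rotZ α b)) = rotZ α (v x))
    (x : EuclideanSpace ℝ (Fin 3)) : v (rotZ α x + b) = rotZ α (v (x + b)) := by
  have rotZ_add_vec : rotZ α (x + b) = rotZ α x + rotZ α b := (rotZL α).map_add x b
  rw [← h (x + b), rotZ_add_vec]
  congr 1
  abel

/-- **The symmetry almost commutes with the limit.** If `v ∘ A = R_α ∘ v` exactly, where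
`A x = R_α x + e` is a screw motion, then for any `L³` field `u`,
`‖u ∘ A − R_α ∘ u‖_{L³} ≤ 2 ‖v − u‖_{L³}`. [folklore] -/
theorem eLpNorm_comp_motion_sub_rotZ_apply_le {u v : EuclideanSpace ℝ (Fin 3) → EuclideanSpace ℝ (Fin 3)}
    (hu : MemLp u 3 volume) (hv : MemLp v 3 volume) {α : ℝ} {e : EuclideanSpace ℝ (Fin 3)}
    (h : ∀ x, v (rotZ α x + e) = rotZ α (v x)) :
    eLpNorm (fun x => u (rotZ α x + e) - rotZ α (u x)) 3 volume ≤ 2 * eLpNorm (v - u) 3 volume := by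
  have rotZ_sub_vec : ∀ y z : EuclideanSpace ℝ (Fin 3), rotZ α (y - z) = rotZ α y - rotZ α z :=
    fun y z => (rotZL α).map_sub y z
  have hmp := measurePreserving_motion α e
  set F : EuclideanSpace ℝ (Fin 3) → EuclideanSpace ℝ (Fin 3) :=
    fun x => u (rotZ α x + e) - v (rotZ α x + e) with hF
  set G : EuclideanSpace ℝ (Fin 3) → EuclideanSpace ℝ (Fin 3) :=
    fun x => rotZ α (v x) - rotZ α (u x) with hG
  have hFm : AEStronglyMeasurable F volume :=
    (hu.sub hv).aestronglyMeasurable.comp_measurePreserving hmp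
  have hGm : AEStronglyMeasurable G volume := by
    have h1 : G = fun x => rotZ α ((v - u) x) := by
      funext x
      simp only [hG, Pi.sub_apply, rotZ_sub_vec]
    rw [h1]
    exact (rotZL α).continuous.comp_aestronglyMeasurable (hv.aestronglyMeasurable.sub hu.aestronglyMeasurable)
  have hsplit : (fun x => u (rotZ α x + e) - rotZ α (u x)) = F + G := by
    funext x
    simp only [hF, hG, Pi.add_apply, h x, sub_add_sub_cancel]
  have h1 : eLpNorm F 3 volume = eLpNorm (v - u) 3 volume := by
    rw [eLpNorm_sub_comm v u]
    exact eLpNorm_comp_measurePreserving (p := 3) (hu.sub hv).aestronglyMeasurable hmp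
  have h2 : eLpNorm G 3 volume = eLpNorm (v - u) 3 volume := by
    refine eLpNorm_congr_norm_ae (Eventually.of_forall fun x => ?_)
    simp only [hG, Pi.sub_apply, ← rotZ_sub_vec, norm_rotZ]
  rw [hsplit]
  refine (eLpNorm_add_le hFm hGm (by norm_num)).trans (le_of_eq ?_)
  rw [h1, h2, two_mul]

/-- **Size of the horizontal displacement.** For a horizontal vector `b` (`b 2 = 0`),
`‖b − R_φ b‖² = 2 (1 − cos φ) ‖b‖²`. [folklore] -/
theorem norm_sub_rotZ_sq {b : EuclideanSpace ℝ (Fin 3)} (hb : b 2 = 0) (φ : ℝ) :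
    ‖b - rotZ φ b‖ ^ 2 = 2 * (1 - Real.cos φ) * ‖b‖ ^ 2 := by
  rw [EuclideanSpace.norm_eq, EuclideanSpace.norm_eq,
    Real.sq_sqrt (Finset.sum_nonneg fun i _ => sq_nonneg _),
    Real.sq_sqrt (Finset.sum_nonneg fun i _ => sq_nonneg _)]
  simp only [Fin.sum_univ_three, Real.norm_eq_abs, sq_abs, PiLp.sub_apply, rotZ_apply_zero,
    rotZ_apply_one, rotZ_apply_two, hb, sub_self]
  linear_combination (b 0 ^ 2 + b 1 ^ 2) * Real.sin_sq_add_cos_sq φ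

/-- **Lower bound for the displacement.** For a horizontal `b` and `0 ≤ φ ≤ π`:
`‖b − R_φ b‖ ≥ (2/π) φ ‖b‖` (Jordan's inequality for `sin (φ/2)`). [folklore] -/
theorem mul_norm_le_norm_sub_rotZ {b : EuclideanSpace ℝ (Fin 3)} (hb : b 2 = 0) {φ : ℝ}
    (h0 : 0 ≤ φ) (hπ : φ ≤ Real.pi) : 2 / Real.pi * φ * ‖b‖ ≤ ‖b - rotZ φ b‖ := by
  have hJ : 2 / Real.pi * (φ / 2) ≤ Real.sin (φ / 2) :=
    Real.mul_le_sin (by linarith) (by linarith)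
  have hJ0 : 0 ≤ 2 / Real.pi * (φ / 2) := by positivity
  have hcos : 1 - Real.cos φ = 2 * Real.sin (φ / 2) ^ 2 := by
    rw [Real.sin_sq_eq_half_sub, show 2 * (φ / 2) = φ by ring]; ring
  have hsq : (2 / Real.pi * φ * ‖b‖) ^ 2 ≤ ‖b - rotZ φ b‖ ^ 2 := by
    rw [norm_sub_rotZ_sq hb, hcos]
    have h1 : (2 / Real.pi * (φ / 2)) ^ 2 ≤ Real.sin (φ / 2) ^ 2 := pow_le_pow_left₀ hJ0 hJ 2
    nlinarith [sq_nonneg ‖b‖, mul_le_mul_of_nonneg_right h1 (sq_nonneg ‖b‖)]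
  have hl : 0 ≤ 2 / Real.pi * φ * ‖b‖ := by positivity
  exact (pow_le_pow_iff_left₀ hl (norm_nonneg _) two_ne_zero).1 hsq

/-! ### Axis pinning -/

/-- **Axis pinning (the load-bearing lemma of the line).** Let `u ∈ L³` be non-zero and let
`v_j → u` in `L³`, where each `v_j` is EXACTLY equivariant under the rotation by `θ_j > 0` about
the vertical axis through the horizontal point `b_j` — together with all its iterates:
`v_j (R_{mθ_j} x + (b_j − R_{mθ_j} b_j)) = R_{mθ_j} (v_j x)` — and `θ_j → 0`. Then the offsets
`‖b_j‖` are bounded. Otherwise, along a subsequence `D_j = ‖b_j‖ → ∞`; with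
`m_j = ⌈(θ_j D_j)⁻¹⌉` the `m_j`-th iterate is a rotation by `φ_j = m_j θ_j → 0` composed with a
horizontal translation of length `≥ (2/π) φ_j D_j ≥ 2/π`, and `‖u ∘ A_j − u‖_{L³} → 0` along these
motions forces `u = 0` (`eLpNorm_eq_zero_of_tendsto_motion_of_norm_ge`). [folklore] -/
theorem horizontal_offsets_bounded {u : EuclideanSpace ℝ (Fin 3) → EuclideanSpace ℝ (Fin 3)}
    (hu : MemLp u 3 volume) (hu0 : eLpNorm u 3 volume ≠ 0)
    {v : ℕ → EuclideanSpace ℝ (Fin 3) → EuclideanSpace ℝ (Fin 3)} (hv : ∀ j, MemLp (v j) 3 volume)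
    (hconv : Tendsto (fun j => eLpNorm (v j - u) 3 volume) atTop (𝓝 0))
    {θ : ℕ → ℝ} (hθpos : ∀ j, 0 < θ j) (hθ : Tendsto θ atTop (𝓝 0))
    {b : ℕ → EuclideanSpace ℝ (Fin 3)} (hb2 : ∀ j, b j 2 = 0)
    (hequiv : ∀ j (m : ℕ) x,
      v j (rotZ (m * θ j) x + (b j - rotZ (m * θ j) (b j))) = rotZ (m * θ j) (v j x)) :
    ∃ C : ℝ, ∀ j, ‖b j‖ ≤ C := by
  by_contra hC
  push Not at hC
  -- a subsequence with `‖b (ψ n)‖ ≥ n + 1` and `θ (ψ n) ≤ 1`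
  have hfreq : ∀ n : ℕ, ∃ᶠ k in atTop, (n : ℝ) + 1 ≤ ‖b k‖ ∧ θ k ≤ 1 := by
    intro n
    have hev : ∀ᶠ k in atTop, θ k ≤ 1 := hθ.eventually (eventually_le_nhds one_pos)
    refine Frequently.and_eventually ?_ hev
    rw [frequently_atTop]
    intro N
    obtain ⟨j, hj⟩ := hC (max ((n : ℝ) + 1) (∑ k ∈ Finset.range N, ‖b k‖))
    refine ⟨j, ?_, (le_max_left _ _).trans hj.le⟩
    by_contra hjN
    push Not at hjN
    have h1 : ‖b j‖ ≤ ∑ k ∈ Finset.range N, ‖b k‖ :=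
      Finset.single_le_sum (f := fun k => ‖b k‖) (fun k _ => norm_nonneg (b k))
        (Finset.mem_range.2 hjN)
    exact absurd ((le_max_right _ _).trans_lt hj) (not_lt.2 h1)
  obtain ⟨ψ, hψ, hψP⟩ := extraction_forall_of_frequently hfreq
  -- notation along the subsequence
  set D : ℕ → ℝ := fun n => ‖b (ψ n)‖ with hD
  set t : ℕ → ℝ := fun n => θ (ψ n) * D n with ht
  set m : ℕ → ℕ := fun n => ⌈(t n)⁻¹⌉₊ with hm
  set φ : ℕ → ℝ := fun n => (m n : ℝ) * θ (ψ n) with hφ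
  set c : ℕ → EuclideanSpace ℝ (Fin 3) := fun n => b (ψ n) - rotZ (φ n) (b (ψ n)) with hc
  have hDge : ∀ n : ℕ, (n : ℝ) + 1 ≤ D n := fun n => (hψP n).1
  have hθ1 : ∀ n, θ (ψ n) ≤ 1 := fun n => (hψP n).2
  have hDpos : ∀ n : ℕ, 0 < D n := fun n => lt_of_lt_of_le (by positivity) (hDge n)
  have htpos : ∀ n, 0 < t n := fun n => mul_pos (hθpos _) (hDpos n)
  have hmt : ∀ n, 1 ≤ (m n : ℝ) * t n := fun n => by
    have h1 : (t n)⁻¹ ≤ m n := Nat.le_ceil _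
    calc (1 : ℝ) = (t n)⁻¹ * t n := (inv_mul_cancel₀ (htpos n).ne').symm
      _ ≤ m n * t n := mul_le_mul_of_nonneg_right h1 (htpos n).le
  have hφD : ∀ n, 1 ≤ φ n * D n := fun n => by
    have := hmt n
    rw [ht] at this
    simpa [hφ, mul_assoc] using this
  have hφpos : ∀ n, 0 < φ n := fun n => by
    have h1 := hφD n
    by_contra h0
    push Not at h0
    have : φ n * D n ≤ 0 := mul_nonpos_of_nonpos_of_nonneg h0 (hDpos n).le
    linarith
  have hφlt : ∀ n, φ n < (D n)⁻¹ + θ (ψ n) := fun n => by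
    have h1 : (m n : ℝ) < (t n)⁻¹ + 1 := Nat.ceil_lt_add_one (inv_nonneg.2 (htpos n).le)
    have h2 : φ n < ((t n)⁻¹ + 1) * θ (ψ n) := by
      rw [hφ]
      exact mul_lt_mul_of_pos_right h1 (hθpos _)
    have h3 : ((t n)⁻¹ + 1) * θ (ψ n) = (D n)⁻¹ + θ (ψ n) := by
      have hθne : θ (ψ n) ≠ 0 := (hθpos _).ne'
      have hDne : D n ≠ 0 := (hDpos n).ne'
      simp only [ht, mul_inv, add_mul, one_mul]
      rw [mul_comm (θ (ψ n))⁻¹ (D n)⁻¹, mul_assoc, inv_mul_cancel₀ hθne, mul_one]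
    linarith
  have hφle : ∀ n, φ n ≤ 2 := fun n => by
    have h1 : (D n)⁻¹ ≤ 1 := inv_le_one_of_one_le₀ (by linarith [hDge n, (n.cast_nonneg : (0:ℝ) ≤ n)])
    linarith [hφlt n, hθ1 n]
  have hφ0 : Tendsto φ atTop (𝓝 0) := by
    have hDinv : Tendsto (fun n => (D n)⁻¹) atTop (𝓝 0) := by
      refine tendsto_inv_atTop_zero.comp ?_
      refine tendsto_atTop_mono hDge ?_
      exact tendsto_natCast_atTop_atTop.atTop_add tendsto_const_nhds
    have hsum : Tendsto (fun n => (D n)⁻¹ + θ (ψ n)) atTop (𝓝 0) := by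
      simpa using hDinv.add (hθ.comp hψ.tendsto_atTop)
    exact tendsto_of_tendsto_of_tendsto_of_le_of_le tendsto_const_nhds hsum
      (fun n => (hφpos n).le) (fun n => (hφlt n).le)
  have hcge : ∀ n, 2 / Real.pi ≤ ‖c n‖ := fun n => by
    have h1 := mul_norm_le_norm_sub_rotZ (hb2 (ψ n)) (hφpos n).le
      ((hφle n).trans (by linarith [Real.pi_gt_three]))
    have h2 : 2 / Real.pi ≤ 2 / Real.pi * φ n * ‖b (ψ n)‖ := by
      have := hφD n
      rw [hD] at this
      have h3 : 2 / Real.pi * φ n * ‖b (ψ n)‖ = 2 / Real.pi * (φ n * ‖b (ψ n)‖) := by ring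
      rw [h3]
      exact le_mul_of_one_le_right (by positivity) this
    exact h2.trans h1
  -- `‖u ∘ A_n − u‖ → 0` along the motions `A_n x = R_{φ_n} x + c_n`
  have hmotion : Tendsto (fun n => eLpNorm (fun x => u (rotZ (φ n) x + c n) - u x) 3 volume)
      atTop (𝓝 0) := by
    have hmeasA : ∀ n, AEStronglyMeasurable (fun x => u (rotZ (φ n) x + c n)) volume := fun n =>
      hu.aestronglyMeasurable.comp_measurePreserving (measurePreserving_motion _ _)
    have hmeasR : ∀ n, AEStronglyMeasurable (fun x => rotZ (φ n) (u x)) volume := fun n =>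
      (rotZL (φ n)).continuous.comp_aestronglyMeasurable hu.aestronglyMeasurable
    have hle : ∀ n, eLpNorm (fun x => u (rotZ (φ n) x + c n) - u x) 3 volume ≤
        2 * eLpNorm (v (ψ n) - u) 3 volume +
          eLpNorm (fun x => rotZ (φ n) (u x) - rotZ 0 (u x)) 3 volume := fun n => by
      have hsplit : (fun x => u (rotZ (φ n) x + c n) - u x) =
          (fun x => u (rotZ (φ n) x + c n) - rotZ (φ n) (u x)) +
            fun x => rotZ (φ n) (u x) - rotZ 0 (u x) := by
        funext x
        simp only [Pi.add_apply, rotZ_zero, sub_add_sub_cancel]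
      rw [hsplit]
      refine (eLpNorm_add_le ((hmeasA n).sub (hmeasR n)) ((hmeasR n).sub ?_) (by norm_num)).trans ?_
      · exact hu.aestronglyMeasurable.congr (Eventually.of_forall fun x => by simp only [rotZ_zero])
      · refine add_le_add ?_ le_rfl
        exact eLpNorm_comp_motion_sub_rotZ_apply_le hu (hv (ψ n)) (fun x => hequiv (ψ n) (m n) x)
    have hlim : Tendsto (fun n => 2 * eLpNorm (v (ψ n) - u) 3 volume +
        eLpNorm (fun x => rotZ (φ n) (u x) - rotZ 0 (u x)) 3 volume) atTop (𝓝 0) := by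
      have h1 : Tendsto (fun n => 2 * eLpNorm (v (ψ n) - u) 3 volume) atTop (𝓝 0) := by
        have := ENNReal.Tendsto.const_mul (a := (2 : ℝ≥0∞)) (hconv.comp hψ.tendsto_atTop)
          (Or.inr (ENNReal.ofNat_ne_top (n := 2)))
        simpa using this
      have h2 := tendsto_eLpNorm_rotZ_apply_sub hu hφ0
      simpa using h1.add h2
    exact tendsto_of_tendsto_of_tendsto_of_le_of_le tendsto_const_nhds hlim (fun _ => zero_le) hle
  exact hu0 (eLpNorm_eq_zero_of_tendsto_motion_of_norm_ge hu hφ0 (by positivity) hcge hmotion)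

/-- **Registered helper stub `stub_offsetsBounded`** (crux stmt-NavierStokesRegularity-15454, line
`birth`; the statement of `horizontal_offsets_bounded` with the rotations written out in
coordinates, as in the route file). [folklore] -/
theorem stub_offsetsBounded :
    ∀ (u : EuclideanSpace ℝ (Fin 3) → EuclideanSpace ℝ (Fin 3)) (v : ℕ → EuclideanSpace ℝ (Fin 3) → EuclideanSpace ℝ (Fin 3)) (θ : ℕ → ℝ) (b : ℕ → EuclideanSpace ℝ (Fin 3)), MemLp u 3 volume → eLpNorm u 3 volume ≠ 0 → (∀ j, MemLp (v j) 3 volume) → Tendsto (fun j => eLpNorm (v j - u) 3 volume) atTop (𝓝 0) → (∀ j, 0 < θ j) → Tendsto θ atTop (𝓝 0) → (∀ j, b j 2 = 0) → (∀ (j m : ℕ) (x : EuclideanSpace ℝ (Fin 3)), v j (WithLp.toLp 2 ![Real.cos ((m : ℝ) * θ j) * x 0 - Real.sin ((m : ℝ) * θ j) * x 1, Real.sin ((m : ℝ) * θ j) * x 0 + Real.cos ((m : ℝ) * θ j) * x 1, x 2] + (b j - WithLp.toLp 2 ![Real.cos ((m : ℝ) * θ j) * b j 0 - Real.sin ((m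 : ℝ) * θ j) * b j 1, Real.sin ((m : ℝ) * θ j) * b j 0 + Real.cos ((m : ℝ) * θ j) * b j 1, b j 2])) = WithLp.toLp 2 ![Real.cos ((m : ℝ) * θ j) * v j x 0 - Real.sin ((m : ℝ) * θ j) * v j x 1, Real.sin ((m : ℝ) * θ j) * v j x 0 + Real.cos ((m : ℝ) * θ j) * v j x 1, v j x 2]) → ∃ C : ℝ, ∀ j, ‖b j‖ ≤ C :=
  fun _u _v _θ _b hu hu0 hv hconv hθpos hθ hb2 hequiv =>
    horizontal_offsets_bounded hu hu0 hv hconv hθpos hθ hb2 hequiv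

end Summit.NavierStokesRegularity.NavierStokesRegularity.Theorems.PFoldToAxisymmetric.AxisPinning

end
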